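import Literature.Probability.LatticeModels.BalabanStepOneFormatXYBonds

/-!
# Balaban's step-one format — calibration, part 2b: the XY bond action is a quasi-local action

The small-field half of the membership of the XY Gibbs weight in Balaban's step-one format
(`SPLIT-PROPOSAL.md` §4(a) of crux `BirGappedPhaseReductionR`, route BalabanIR of
`HubbardSuperconductivity`): the bond action

  `xyAction K X z = K · (1 - cos ∂_b z)` if `X = {s, s + eᵢ}` is the endpoint pair of the bond `b`, else `0`,

satisfies every clause of `QuasiLocalAction K 14 κ` for `K > 1`, `η(K) ≤ 1/5`, `κ ≥ 0`
(`xyAction_quasiLocalAction`): locality, translation covariance, U(1), `2π`-periodicity,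
(R)-Hermiticity, (P)-evenness, vanishing at constants, holomorphy (it is entire), and the BUDGET
`Σ_{X ∋ s₀} sup_{sfDomain} |A X| · e^{κ(|X|-2)} ≤ 14 log² K`: on the small-field domain of an endpoint
pair (`cos 2η < cos (Re ∂z)`, `|Im ∂z| < η/8`) one has `|1 - cos ∂z| ≤ (21/10) η²`
(`norm_one_sub_ccos_le_of_sf`, from `|1 - cos w| ≤ |w|²/2 + (5/96)|w|⁴` after reduction of `Re ∂z`
modulo `2π`), `K η(K)² = log² K`, and at most six bonds contain a given site.  Folklore.
-/

noncomputable section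

open scoped BigOperators Classical
open Finset

namespace Literature.Probability.LatticeModels.BalabanStepOne

variable {L' M : ℕ} [NeZero L'] [NeZero M]

/-- **The XY bond action** as a family indexed by site sets: `A X z = K · (1 - cos ∂_b z)` when `X`
is the endpoint pair of the bond `b` (summed over all bonds with that endpoint pair — one bond unless
the torus is degenerate), and `0` otherwise. [folklore] -/
def xyAction (K : ℝ) (X : Finset (Site L' M)) (z : Site L' M → ℂ) : ℂ :=
  (K : ℂ) * ∑ b : Site L' M × Fin 3, if X = edge b then (1 - Complex.cos (grad z b)) else 0


/-! #### The cosine bound on the small-field domain -/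

/-- `|1 - cos w| ≤ |w|²/2 + (5/96)|w|⁴` for `|w| ≤ 1`. [folklore] -/
theorem norm_one_sub_ccos_le {w : ℂ} (hw : ‖w‖ ≤ 1) :
    ‖1 - Complex.cos w‖ ≤ ‖w‖ ^ 2 / 2 + ‖w‖ ^ 4 * (5 / 96) := by
  have h := Complex.cos_bound hw
  have h1 : 1 - Complex.cos w = w ^ 2 / 2 - (Complex.cos w - (1 - w ^ 2 / 2)) := by ring
  rw [h1]
  refine (norm_sub_le _ _).trans ?_
  have h2 : ‖w ^ 2 / 2‖ = ‖w‖ ^ 2 / 2 := by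
    rw [norm_div, norm_pow]; norm_num
  rw [h2]
  linarith

/-- Reduction of a real number modulo `2π` into `(-2η, 2η)` from `cos (2η) < cos x` (`0 < 2η ≤ π`).
[folklore] -/
theorem exists_abs_sub_int_mul_two_pi_lt {η x : ℝ} (hη : 0 < η) (hη' : 2 * η ≤ Real.pi)
    (hx : Real.cos (2 * η) < Real.cos x) : ∃ n : ℤ, |x - n * (2 * Real.pi)| < 2 * η := by
  refine ⟨round (x / (2 * Real.pi)), ?_⟩
  set n : ℤ := round (x / (2 * Real.pi)) with hn
  have hpi : 0 < Real.pi := Real.pi_pos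
  have hr := abs_sub_round (x / (2 * Real.pi))
  have hx' : |x - n * (2 * Real.pi)| ≤ Real.pi := by
    have : x - n * (2 * Real.pi) = (x / (2 * Real.pi) - n) * (2 * Real.pi) := by
      field_simp
    rw [this, abs_mul, abs_of_pos (by positivity : (0 : ℝ) < 2 * Real.pi)]
    nlinarith
  set y := x - n * (2 * Real.pi) with hy
  have hcos : Real.cos y = Real.cos x := by
    rw [hy, sub_eq_add_neg, ← neg_mul, show -(n : ℝ) * (2 * Real.pi) = ((-n : ℤ) : ℝ) * (2 * Real.pi) by
      push_cast; ring, Real.cos_add_int_mul_two_pi]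
  by_contra hlt
  have hle : 2 * η ≤ |y| := not_lt.1 hlt
  have h1 : Real.cos |y| ≤ Real.cos (2 * η) :=
    Real.cos_le_cos_of_nonneg_of_le_pi (by linarith) hx' hle
  rw [Real.cos_abs, hcos] at h1
  linarith

/-- **The bond term on the small-field domain.** If `cos (2η) < cos (Re w)` and `|Im w| < η/8` with
`0 < η ≤ 1/5`, then `|1 - cos w| ≤ (21/10) η²`. [folklore] -/
theorem norm_one_sub_ccos_le_of_sf {η : ℝ} {w : ℂ} (hη : 0 < η) (hη' : η ≤ 1 / 5)
    (hre : Real.cos (2 * η) < Real.cos w.re) (him : |w.im| < η / 8) :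
    ‖1 - Complex.cos w‖ ≤ 21 / 10 * η ^ 2 := by
  have hpi : 2 * η ≤ Real.pi := by linarith [Real.pi_gt_three]
  obtain ⟨n, hn⟩ := exists_abs_sub_int_mul_two_pi_lt hη hpi hre
  set w' : ℂ := w - n * (2 * Real.pi) with hw'
  have hcos : Complex.cos w = Complex.cos w' := by
    rw [hw', sub_eq_add_neg, ← neg_mul,
      show -(n : ℂ) * (2 * Real.pi) = ((-n : ℤ) : ℂ) * (2 * Real.pi) by push_cast; ring,
      Complex.cos_add_int_mul_two_pi]
  have hre' : w'.re = w.re - n * (2 * Real.pi) := by simp [hw']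
  have him' : w'.im = w.im := by simp [hw']
  have h1 : |w'.re| < 2 * η := by rw [hre']; exact hn
  have h2 : |w'.im| < η / 8 := by rw [him']; exact him
  have hnorm_sq : ‖w'‖ ^ 2 ≤ (4 + 1 / 64) * η ^ 2 := by
    rw [Complex.sq_norm, Complex.normSq_apply]
    have := abs_lt.1 h1; have := abs_lt.1 h2
    nlinarith
  have hη2 : η ^ 2 ≤ 1 / 25 := by nlinarith
  have hnorm : ‖w'‖ ≤ 1 := by
    have h0 : 0 ≤ ‖w'‖ := norm_nonneg _
    nlinarith
  rw [hcos]
  refine (norm_one_sub_ccos_le hnorm).trans ?_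
  have h4 : ‖w'‖ ^ 4 = (‖w'‖ ^ 2) ^ 2 := by ring
  rw [h4]
  have h0 : 0 ≤ ‖w'‖ ^ 2 := by positivity
  nlinarith

/-- `η(K)² = log² K / K` for `K > 0`. [folklore] -/
theorem eta_sq {K : ℝ} (hK : 0 < K) : eta K ^ 2 = Real.log K ^ 2 / K := by
  unfold eta
  rw [div_pow, Real.sq_sqrt hK.le]

omit [NeZero L'] [NeZero M] in
/-- On the small-field domain of an endpoint pair, the bond term is at most `(21/10) log² K`.
[folklore] -/
theorem norm_xy_bond_le {K : ℝ} (hK : 1 < K) (hη : eta K ≤ 1 / 5) {b : Site L' M × Fin 3}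
    {z : Site L' M → ℂ} (hz : z ∈ sfDomain K (edge b)) :
    ‖(K : ℂ) * (1 - Complex.cos (grad z b))‖ ≤ 21 / 10 * Real.log K ^ 2 := by
  have hK0 : 0 < K := by linarith
  have hηpos : 0 < eta K := by
    unfold eta
    exact div_pos (Real.log_pos hK) (Real.sqrt_pos.2 hK0)
  have hmem1 : b.1 ∈ edge b := by simp [edge]
  have hmem2 : b.1 + dir L' M b.2 ∈ edge b := by simp [edge]
  obtain ⟨hre, him⟩ := hz b.1 hmem1 b.2 hmem2
  have h := norm_one_sub_ccos_le_of_sf hηpos hη hre him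
  rw [norm_mul, Complex.norm_real, Real.norm_eq_abs, abs_of_pos hK0]
  calc K * ‖1 - Complex.cos (grad z b)‖ ≤ K * (21 / 10 * eta K ^ 2) := by
        exact mul_le_mul_of_nonneg_left h hK0.le
    _ = 21 / 10 * Real.log K ^ 2 := by rw [eta_sq hK0]; field_simp

/-- At most six bonds have a given site as an endpoint. [folklore] -/
theorem card_filter_mem_edge_le (s₀ : Site L' M) :
    (univ.filter fun b : Site L' M × Fin 3 => s₀ ∈ edge b).card ≤ 6 := by
  have hsub : (univ.filter fun b : Site L' M × Fin 3 => s₀ ∈ edge b) ⊆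
      (univ : Finset (Fin 3)).image (fun i => (s₀, i)) ∪
        (univ : Finset (Fin 3)).image fun i => (s₀ - dir L' M i, i) := by
    intro b hb
    have h := (mem_filter.1 hb).2
    simp only [edge, mem_insert, mem_singleton] at h
    rcases h with h | h
    · exact mem_union_left _ (mem_image.2 ⟨b.2, mem_univ _, by rw [h]⟩)
    · refine mem_union_right _ (mem_image.2 ⟨b.2, mem_univ _, ?_⟩)
      rw [h, add_sub_cancel_right]
  refine (card_le_card hsub).trans ((card_union_le _ _).trans ?_)
  have h1 : ((univ : Finset (Fin 3)).image fun i => (s₀, i)).card ≤ 3 := card_image_le.trans (by simp)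
  have h2 : ((univ : Finset (Fin 3)).image fun i => (s₀ - dir L' M i, i)).card ≤ 3 :=
    card_image_le.trans (by simp)
  omega

/-- **Calibration (γ).** The XY bond action is a quasi-local small-field action with budget `B = 14`
(for `K > 1`, `η(K) ≤ 1/5`, `κ ≥ 0`). [folklore] -/
theorem xyAction_quasiLocalAction {K κ : ℝ} (hK : 1 < K) (hη : eta K ≤ 1 / 5) (hκ : 0 ≤ κ) :
    QuasiLocalAction K 14 κ L' M (xyAction (L' := L') (M := M) K) where
  local_ X z z' h := by
    unfold xyAction
    congr 1
    refine sum_congr rfl fun b _ => ?_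
    split_ifs with hX
    · have h1 : b.1 ∈ X := by rw [hX]; simp [edge]
      have h2 : b.1 + dir L' M b.2 ∈ X := by rw [hX]; simp [edge]
      simp only [grad, h _ h1, h _ h2]
    · rfl
  transl X t z := by
    unfold xyAction
    congr 1
    rw [← Equiv.sum_comp (bondAdd t)]
    refine sum_congr rfl fun b _ => ?_
    simp only [edge_bondAdd, (Finset.image_injective (add_left_injective t)).eq_iff]
    simp only [grad, bondAdd, Equiv.prodCongr_apply, Equiv.coe_addRight, Prod.map_fst, Prod.map_snd,
      Equiv.coe_refl, id_eq, add_right_comm _ t]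
  u1 X z c := by
    unfold xyAction grad
    simp only [add_sub_add_right_eq_sub]
  periodic X z s := by
    unfold xyAction grad
    simp only [ccos_update_two_pi_sub]
  reflHerm X z := by
    unfold xyAction
    rw [map_mul, Complex.conj_ofReal, map_sum]
    congr 1
    rw [← Equiv.sum_comp bondRefl]
    refine sum_congr rfl fun b _ => ?_
    have hb : bondRefl b = (reflBase b.1 b.2, b.2) := rfl
    rw [hb]
    simp only [edge_reflBase, (Finset.image_injective (timeRefl_injective (L' := L') (M := M))).eq_iff,
      ccos_grad_reflBase, apply_ite (starRingEnd ℂ), map_sub, map_one, map_zero, ← Complex.cos_conj]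
    have hg : (starRingEnd ℂ) (grad (fun s => (starRingEnd ℂ) (z s)) b) = grad z b := by
      simp [grad]
    rw [hg]
  inversion X z := by
    unfold xyAction
    congr 1
    rw [← Equiv.sum_comp bondInv]
    refine sum_congr rfl fun b _ => ?_
    have hb : bondInv b = (invBase b.1 b.2, b.2) := rfl
    rw [hb]
    simp only [edge_invBase, (Finset.image_injective (spaceInv_injective (L' := L') (M := M))).eq_iff,
      ccos_grad_invBase]
  norm0 X c := by
    unfold xyAction grad
    simp
  analytic X := by
    apply Differentiable.differentiableOn
    have hb : ∀ b : Site L' M × Fin 3, Differentiable ℂ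
        (fun z : Site L' M → ℂ => if X = edge b then (1 - Complex.cos (grad z b)) else 0) := by
      intro b
      split_ifs
      · unfold grad; fun_prop
      · exact differentiable_const _
    unfold xyAction
    exact (Differentiable.fun_sum fun b _ => hb b).const_mul _
  budget := by
    refine ⟨fun X => ∑ b : Site L' M × Fin 3, if X = edge b then 21 / 10 * Real.log K ^ 2 else 0, ?_, ?_⟩
    · intro X z hz
      unfold xyAction
      rw [mul_sum]
      refine (norm_sum_le _ _).trans (sum_le_sum fun b _ => ?_)
      split_ifs with hX
      · subst hX
        exact norm_xy_bond_le hK hη hz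
      · simp
    · intro s₀
      have hlog : 0 ≤ 21 / 10 * Real.log K ^ 2 := by positivity
      calc ∑ X ∈ univ.filter (fun X : Finset (Site L' M) => s₀ ∈ X),
              (∑ b : Site L' M × Fin 3, if X = edge b then 21 / 10 * Real.log K ^ 2 else 0) *
                Real.exp (κ * ((X.card : ℝ) - 2))
          = ∑ b : Site L' M × Fin 3, ∑ X ∈ univ.filter (fun X : Finset (Site L' M) => s₀ ∈ X),
              (if X = edge b then 21 / 10 * Real.log K ^ 2 * Real.exp (κ * ((X.card : ℝ) - 2))
                else 0) := by
            rw [sum_comm]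
            refine sum_congr rfl fun X _ => ?_
            rw [sum_mul]
            refine sum_congr rfl fun b _ => ?_
            split_ifs <;> simp
        _ = ∑ b : Site L' M × Fin 3, if s₀ ∈ edge b then
              21 / 10 * Real.log K ^ 2 * Real.exp (κ * (((edge b).card : ℝ) - 2)) else 0 := by
            refine sum_congr rfl fun b _ => ?_
            rw [sum_ite_eq' (univ.filter fun X : Finset (Site L' M) => s₀ ∈ X) (edge b)]
            simp only [mem_filter, mem_univ, true_and]
        _ ≤ ∑ b : Site L' M × Fin 3, if s₀ ∈ edge b then 21 / 10 * Real.log K ^ 2 else 0 := by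
            refine sum_le_sum fun b _ => ?_
            split_ifs with hb
            · have hcard : ((edge b).card : ℝ) ≤ 2 := by
                have : (edge b).card ≤ 2 := Finset.card_le_two
                exact_mod_cast this
              have hexp : Real.exp (κ * (((edge b).card : ℝ) - 2)) ≤ 1 := by
                rw [Real.exp_le_one_iff]
                nlinarith
              calc 21 / 10 * Real.log K ^ 2 * Real.exp (κ * (((edge b).card : ℝ) - 2))
                  ≤ 21 / 10 * Real.log K ^ 2 * 1 := mul_le_mul_of_nonneg_left hexp hlog
                _ = _ := mul_one _
            · exact le_rfl
        _ = (21 / 10 * Real.log K ^ 2) * ((univ.filter fun b : Site L' M × Fin 3 => s₀ ∈ edge b).card : ℝ) := by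
            rw [← sum_filter, sum_const, nsmul_eq_mul, mul_comm]
        _ ≤ (21 / 10 * Real.log K ^ 2) * 6 := by
            refine mul_le_mul_of_nonneg_left ?_ hlog
            exact_mod_cast card_filter_mem_edge_le s₀
        _ ≤ 14 * Real.log K ^ 2 := by nlinarith [sq_nonneg (Real.log K)]

end Literature.Probability.LatticeModels.BalabanStepOne

end
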